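import Literature.AnabelianGeometry.EtaleTheta.SettingModelChiProp15ii
import Literature.AnabelianGeometry.EtaleTheta.SettingModelChiThetaCocycle
import HarnessLib

/-!
# The χ-twisted root model of [EtTh] §1: the model's étale theta class `η^Θ` IS INFLATED from the theta quotient,
# by a class restricting to `log(Θ)` — clause (a) of Prop. 1.5 (iii) for `etaχ` / `etaDdχ` (proof-only)

Mochizuki, *The étale theta function …*, Publ. RIMS **45** (2009) [EtTh], §1, Prop. 1.5 (iii), PRIMS PDF p. 23
[cite: MochizukiEtTh2009, Prop 1.5 (iii) p.23]: "Any class `η̈^Θ ∈ H¹(Π^tp_Ÿ, Δ_Θ)` arises from a unique class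
`η̈^Θ ∈ H¹((Π^tp_Ÿ)^Θ, Δ_Θ)` that maps to `log(Θ)` in the quotient `F̈⁰/F̈¹`", and Prop. 1.3 p. 20 (the restriction of
`η^Θ` to the geometric part "is the natural isomorphism").

PROOF-ONLY file (abc-iut cell, layer L2; seat abc-iut-L6-d5 gen 4, pair R184 (ii)/(iii) with abc-iut-L2-t12; no
definition, no instance, no `Prop` fact). abc-iut-L2-d1's `SettingModelChiThetaCocycle.lean` (R78 hand #2″) gives THE
theta class of the χ-model as the class `etaχ ∈ H¹(Π^tp_Y, Δ_Θ)` of the cocycle `g ↦ toTheta (inl (centreRep g.left))`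
(levels `(0, 0, z_N)`), and `etaDdχ := etaχ|_Ÿ`. This file proves that these classes LIFT to the theta quotient:

* `SettingModel.toTheta_inl_centreRep_eq_cThetaχ` — `toTheta (inl (centreRep γ)) = c^t` whenever `ĥ_N(pr₁ γ).z = t mod N`
  for all `N` (`γ ∈ Ker pr₂`): two elements of `Γ` with trivial Galois part and the SAME levels `(0,0,z_N)` agree in
  `(Π^tp_X)^Θ` (abc-iut-L6-d6's `toTheta_eq_of_right_eq_one`);
* **`SettingModel.exists_thetaLift_etaχ`** — there is `x′ ∈ H¹((Π^tp_Y)^Θ, Δ_Θ)` with `infl x′ = etaχ` AND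
  `x′|_{Δ_Θ} = log(Θ)`: the class of the `z`-COORDINATE crossed homomorphism `h ↦ c^{ẑ(h)}` of this seat's
  `SettingModelChiProp15ii.lean` (there used for clause (a) of Prop. 1.5 (i)/(ii)), which descends `ĥ_N(·).z` to
  `(Π^tp_X)^Θ` and, composed with `Π^tp_Y ↠ (Π^tp_Y)^Θ`, is L2-d1's cocycle ON THE NOSE;
* **`SettingModel.exists_thetaLift_etaDdχ`** — the same on `Ÿ`: `infl x′ = etaDdχ`, `x′|_{Δ_Θ} = log(Θ)` — i.e. binder
  (a) of abc-iut-L2-t6's `KummerData.prop15iii_etaleThetaDataOfClass_of_lift` at `(modelχ, η := etaDdχ)`, so that at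
  the split model ONLY the `Z`-action law (c) of the typed Prop. 1.5 (iii) remains (and it FAILS there by design:
  abc-iut-L2-t12's `not_prop15iii_of_conj_logUdd_mem_units` — the Tate shear of stage 2 is what produces it);
* `SettingModel.etaχ_mem_range_inflTheta`, `SettingModel.etaDdχ_mem_range_inflTheta` — census forms.

HONEST FRAMING: SEMI-SYNTHETIC model (the χ-twisted root, «split-Tate»); consistency / non-vacuity evidence for the
typed interface ONLY; nothing of [EtTh] is asserted; typed ≠ proved; no side is taken on [IUTchIII] Cor. 3.12.
-/

noncomputable section

open CategoryTheory ProfiniteGrp ProfiniteGrp.ProfiniteCompletion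

namespace Literature.AnabelianGeometry.EtaleTheta.SettingModel

open Literature.AnabelianGeometry.SemiGraphs _root_.Topology _root_.Function
open scoped IsMulCommutative commutatorElement

variable (p : ℕ) [Fact p.Prime]

/-- **`toTheta (inl (centreRep γ)) = c^t`** for `γ ∈ Ker pr₂` whose `z`-levels are those of `t ∈ Ẑ`: both sides have
trivial Galois component and levels `(0, 0, t mod N)`. [cite: MochizukiEtTh2009, Prop 1.3 p.20] -/
theorem toTheta_inl_centreRep_eq_cThetaχ {γ : Gfp} (hγ : γ ∈ gfpSnd.ker) {t : ZH}
    (ht : ∀ N : ℕ+, (levelHom N γ).z = Multiplicative.toAdd (modN N t)) :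
    CurveTheta.toTheta (curveχ p) (SemidirectProduct.inl (centreRep γ)) = cThetaχ p t := by
  rw [cThetaχ_apply]
  refine toTheta_eq_of_right_eq_one p _ _ (SemidirectProduct.right_inl _) (SemidirectProduct.right_inl _) ?_
  rw [SemidirectProduct.left_inl, SemidirectProduct.left_inl, gfpFst_cGfpχ, mem_closure_commutator₃_iff_forall_hHat]
  intro N
  have h1 : hHat N (gfpFst (centreRep γ)) = ⟨0, 0, (levelHom N γ).z⟩ := levelHom_centreRep N hγ
  rw [map_mul, map_inv, h1, hHat_powHat_commutator, ← modN_eq_level, ← ht N, mul_inv_eq_one]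

/-- **The model's `η^Θ` lifts to the theta quotient with restriction `log(Θ)`**: there is
`x′ ∈ H¹((Π^tp_Y)^Θ, Δ_Θ)` whose inflation to `Π^tp_Y` is abc-iut-L2-d1's `etaχ` and whose restriction to `Δ_Θ` is the
identity class `log(Θ)` — the class of the `z`-coordinate crossed homomorphism `h ↦ c^{ẑ(h)}`.
[cite: MochizukiEtTh2009, Prop 1.5 (iii) p.23] -/
theorem exists_thetaLift_etaχ
    (hle : (ThetaSetting.modelχ p).DeltaTheta ≤
      (ThetaSetting.modelχ p).GtpY.map (ThetaSetting.modelχ p).toTheta) :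
    ∃ x : (ThetaSetting.modelχ p).H1Theta ((ThetaSetting.modelχ p).GtpY.map (ThetaSetting.modelχ p).toTheta),
      (ThetaSetting.modelχ p).inflTheta (ThetaSetting.modelχ p).GtpY x = etaχ p ∧
      ContH1.res (MonoidHom.id (ThetaSetting.modelχ p).GtpTheta) (ThetaSetting.modelχ p).DeltaTheta hle x =
        (ThetaSetting.modelχ p).logTheta := by
  -- (1) the `Ẑ`-valued `z`-coordinate on `F̂₂` (levels `ĥ_N(·).z`), as in `exists_res_eq_logTheta_gtpY_modelχ`
  choose zC hzC using fun w : F₂hatT => exists_zHat_forall_hHat_z_eq w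
  have hzext : ∀ {w : F₂hatT} {t : ZH},
      (∀ N : ℕ+, (hHat N w).z = Multiplicative.toAdd (modN N t)) → zC w = t :=
    fun h => ext_of_modN fun N => Multiplicative.toAdd.injective (by rw [hzC, h N])
  have hcont : Continuous zC := by
    refine ZHatLevel.continuous_of_isLocallyConstant_level zC fun N => ?_
    have heq : (fun w : F₂hatT => ZHatLevel.level N (zC w)) = fun w => Multiplicative.ofAdd (hHat N w).z := by
      funext w
      rw [← modN_eq_level, ← hzC w N, ofAdd_toAdd]
    rw [heq]
    exact ((IsLocallyConstant.iff_continuous _).2 (hHat N).continuous).comp fun h => Multiplicative.ofAdd h.z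
  have hmul : ∀ w w' : F₂hatT, eHat w = 1 → zC (w * w') = zC w * zC w' := by
    intro w w' hw
    refine hzext fun N => ?_
    rw [map_mul (modN N), toAdd_mul, hzC w N, hzC w' N, map_mul (hHat N)]
    show (hHat N w).z + (hHat N w').z + (hHat N w).x * (hHat N w').y = _
    rw [hHat_x_eq_zero_of_eHat_eq_one N hw, zero_mul, add_zero]
  have hker : ∀ w w' : F₂hatT, (∀ N : ℕ+, hHat N w' = 1) → zC (w * w') = zC w := fun w w' h =>
    hzext fun N => by rw [map_mul (hHat N), h N, mul_one, hzC]
  have htw : ∀ (φ : MulAut ZH) (w : F₂hatT), zC (twist φ w) = φ (zC w) := by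
    intro φ w
    refine hzext fun N => ?_
    rw [hHat_twist_z, modN_eq_level, ZHatLevel.toAdd_level_aut, ← modN_eq_level, hzC]
  have hc : ∀ t : ZH, zC (powHat (eta ⁅FreeGroup.of (0 : Fin 2), FreeGroup.of 1⁆) t) = t := fun t =>
    hzext fun N => by rw [hHat_powHat_commutator, modN_eq_level]
  -- (2) descent to `(Π^tp_X)^Θ`
  obtain ⟨zT, hzT, hzTc⟩ : ∃ zT : CurveTheta.GTheta (curveχ p) → ZH,
      (∀ g : PiTpχ p, zT (CurveTheta.toTheta (curveχ p) g) = zC (gfpFst g.left)) ∧ Continuous zT := by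
    refine ⟨Quotient.lift (fun g : PiTpχ p => zC (gfpFst g.left)) ?_, fun g => rfl, ?_⟩
    · intro a b hab
      have hab' : a⁻¹ * b ∈ CurveTheta.thetaKer (curveχ p) := QuotientGroup.leftRel_apply.mp hab
      show zC (gfpFst a.left) = zC (gfpFst b.left)
      conv_rhs => rw [← mul_inv_cancel_left a b]
      rw [SemidirectProduct.mul_left, map_mul, gfpFst_actχ, actHatχ_apply]
      exact (hker _ _ fun N => by rw [hHat_twist, ((mem_thetaKerχ_iff p _).mp hab').1 N, map_one]).symm
    · exact (QuotientGroup.isQuotientMap_mk (CurveTheta.thetaKer (curveχ p))).continuous_iff.mpr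
        (hcont.comp (gfpFst.continuous.comp (Semidirect.continuous_left (isInducing_leftRightχ p))))
  have heY : ∀ g : PiTpχ p, g ∈ (ThetaSetting.modelχ p).GtpY → eHat (gfpFst g.left) = 1 := by
    intro g hg
    have h1 : gfpSnd g.left = 1 := hg
    rw [gfpFst_apply, (mem_Gfp _).mp g.left.2]
    change iotaZ (gfpSnd g.left) = 1
    rw [h1, map_one]
  have hlaw : ∀ x y : ↥((ThetaSetting.modelχ p).GtpY.map (ThetaSetting.modelχ p).toTheta),
      zT ((x : CurveTheta.GTheta (curveχ p)) * y) =
        zT x * chi p (CurveTheta.augTheta (curveχ p) x) (zT y) := by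
    rintro ⟨_, g, hg, rfl⟩ ⟨_, h, -, rfl⟩
    show zT (CurveTheta.toTheta (curveχ p) g * CurveTheta.toTheta (curveχ p) h) =
      zT (CurveTheta.toTheta (curveχ p) g) *
        chi p (CurveTheta.augTheta (curveχ p) (CurveTheta.toTheta (curveχ p) g)) (zT (CurveTheta.toTheta (curveχ p) h))
    rw [← map_mul, hzT, hzT, hzT, CurveTheta.augTheta_toTheta, SemidirectProduct.mul_left, map_mul, gfpFst_actχ,
      actHatχ_apply, hmul _ _ (heY g hg), htw]
    rfl
  -- (3) the cocycle `h ↦ c^{ẑ(h)}` on `(Π^tp_Y)^Θ`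
  let f : ↥((ThetaSetting.modelχ p).GtpY.map (ThetaSetting.modelχ p).toTheta) →
      (CurveTheta.thetaToEll (curveχ p)).ker := fun h => deltaThetaCoordχ p (zT h)
  have hf : f ∈ contCocycles (MonoidHom.id (CurveTheta.GTheta (curveχ p))) (CurveTheta.thetaToEll (curveχ p)).ker
      ((ThetaSetting.modelχ p).GtpY.map (ThetaSetting.modelχ p).toTheta) := by
    refine ⟨(continuous_deltaThetaCoordχ p).comp (hzTc.comp continuous_subtype_val), fun x y => ?_⟩
    show deltaThetaCoordχ p (zT ((x : CurveTheta.GTheta (curveχ p)) * y)) =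
      deltaThetaCoordχ p (zT x) *
        MulAut.conjNormal ((MonoidHom.id _) (x : CurveTheta.GTheta (curveχ p))) (deltaThetaCoordχ p (zT y))
    rw [hlaw, map_mul, MonoidHom.id_apply, ← deltaThetaCoordχ_chi]
  refine ⟨ContH1.mk f hf, ?_, ?_⟩
  · -- (4) inflation to `Π^tp_Y` is L2-d1's theta cocycle ON THE NOSE: `c^{ẑ(g)} = toTheta (inl (centreRep g.left))`
    change ContH1.mk (fun g : ↥(ThetaSetting.modelχ p).GtpY => f ⟨(ThetaSetting.modelχ p).toTheta g.1, _⟩) _ =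
      ContH1.mk _ _
    refine ContH1.mk_congr _ (funext fun g => Subtype.ext ?_) _ _
    show ((deltaThetaCoordχ p (zT (CurveTheta.toTheta (curveχ p) g.1)) : (CurveTheta.thetaToEll (curveχ p)).ker) :
        CurveTheta.GTheta (curveχ p)) = CurveTheta.toTheta (curveχ p) (SemidirectProduct.inl (centreRep (g : PiTpχ p).left))
    rw [coe_deltaThetaCoordχ, hzT]
    exact (toTheta_inl_centreRep_eq_cThetaχ p (left_mem_ker_of_mem_GtpY g.2) fun N => (hzC _ N).symm).symm
  · -- (5) restriction to `Δ_Θ = c^Ẑ` is the identity: `ẑ(c^t) = t`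
    change ContH1.mk (fun d => f ⟨d.1, hle d.2⟩) (ContH1.resCocycle _ _ hle ⟨f, hf⟩).2 = ContH1.mk _ _
    refine ContH1.mk_congr _ (funext fun d => ?_) _ _
    obtain ⟨t, ht⟩ := exists_cThetaχ_eq_of_mem_ker p d.2
    apply Subtype.ext
    show ((deltaThetaCoordχ p (zT d.1) : (CurveTheta.thetaToEll (curveχ p)).ker) : CurveTheta.GTheta (curveχ p)) = d.1
    rw [← ht, cThetaχ_apply, hzT, SemidirectProduct.left_inl, gfpFst_cGfpχ, hc, coe_deltaThetaCoordχ, cThetaχ_apply]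

/-- **The model's `η̈^Θ` lifts to `(Π^tp_Ÿ)^Θ` with restriction `log(Θ)`** — binder (a) of abc-iut-L2-t6's
`KummerData.prop15iii_etaleThetaDataOfClass_of_lift` at `(modelχ, η := etaDdχ)` (restrict the `Y`-lift; inflation
commutes with restriction on representing cocycles). [cite: MochizukiEtTh2009, Prop 1.5 (iii) p.23] -/
theorem exists_thetaLift_etaDdχ
    (hle : (ThetaSetting.modelχ p).DeltaTheta ≤
      (ThetaSetting.modelχ p).GtpYdd.map (ThetaSetting.modelχ p).toTheta) :
    ∃ x : (ThetaSetting.modelχ p).H1Theta ((ThetaSetting.modelχ p).GtpYdd.map (ThetaSetting.modelχ p).toTheta),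
      (ThetaSetting.modelχ p).inflTheta (ThetaSetting.modelχ p).GtpYdd x = etaDdχ p ∧
      ContH1.res (MonoidHom.id (ThetaSetting.modelχ p).GtpTheta) (ThetaSetting.modelχ p).DeltaTheta hle x =
        (ThetaSetting.modelχ p).logTheta := by
  obtain ⟨x, hinfl, hres⟩ := exists_thetaLift_etaχ p (hle.trans (ThetaSetting.modelχ p).GtpYddTheta_le)
  refine ⟨ContH1.res _ _ (ThetaSetting.modelχ p).GtpYddTheta_le x, ?_, (ContH1.res_res _ _ x).trans hres⟩
  rw [etaDdχ, ← hinfl]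
  induction x using QuotientGroup.induction_on with
  | H f => rfl

/-- Census form: `etaχ ∈ range (inflTheta Π^tp_Y)` — the model's `η^Θ` "arises from" the theta quotient.
[cite: MochizukiEtTh2009, Prop 1.5 (iii) p.23] -/
theorem etaχ_mem_range_inflTheta :
    etaχ p ∈ Set.range ((ThetaSetting.modelχ p).inflTheta (ThetaSetting.modelχ p).GtpY) := by
  obtain ⟨x, hx, -⟩ := exists_thetaLift_etaχ p
    ((ThetaSetting.modelχ p).compat.deltaTheta_le_DtpYTheta.trans (Subgroup.map_mono inf_le_left))
  exact ⟨x, hx⟩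

/-- Census form: `etaDdχ ∈ range (inflTheta Π^tp_Ÿ)` — the model's `η̈^Θ` "arises from a class of
`H¹((Π^tp_Ÿ)^Θ, Δ_Θ)`". [cite: MochizukiEtTh2009, Prop 1.5 (iii) p.23] -/
theorem etaDdχ_mem_range_inflTheta :
    etaDdχ p ∈ Set.range ((ThetaSetting.modelχ p).inflTheta (ThetaSetting.modelχ p).GtpYdd) := by
  obtain ⟨x, hx, -⟩ := exists_thetaLift_etaDdχ p
    ((ThetaSetting.modelχ p).compat.deltaTheta_le_DtpYddTheta.trans (Subgroup.map_mono inf_le_left))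
  exact ⟨x, hx⟩

end Literature.AnabelianGeometry.EtaleTheta.SettingModel

end
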